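import Literature.AlgebraicGeometry.Resolution.ConjugateDiscs
import Mathlib.FieldTheory.Galois.Basic
import Mathlib.RingTheory.Valuation.ValuationSubring
import Mathlib.FieldTheory.AlgebraicClosure
import Mathlib.Algebra.Polynomial.BigOperators
import HarnessLib

/-!
# The far product of the conjugate discs is rational over the small constant field

Topic: `Literature/AlgebraicGeometry/Resolution` (valued function fields; models of discs over
valuation rings). Companion of `ConjugateDiscs.lean` / `DiscInChart.lean` for the algebraization
step of M. Temkin, *Inseparable local uniformization*, J. Algebra 373 (2013) = arXiv:0804.1554v3,
Thm. 3.3.1, Step 3 (p. 45). With `M|m` finite Galois (inside the algebraic closure `m̃ ⊆ Ω`),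
`a = a_{i₀} ∈ m` with conjugates `aᵢ ∈ M`, and `c ∈ m`: if `Gal(M|m)` permutes the conjugates
and preserves the valuation ring `V` on `M` (the unique-extension situation of
`UniqueExtensionBelowHenselization.lean`), then it preserves the far/near partition
(`|aᵢ − a| > |c|`), so the far product `F = ∏_{far} (X − aᵢ)` is `Gal(M|m)`-invariant and has its
coefficients in `m` (Galois descent: the fixed field of `Gal(M|m)` is `m`).

* `mem_bot_of_forall_algEquiv` — an element of a finite Galois extension fixed by the Galois
  group lies in the ground field — PROVED (Mathlib's Galois correspondence);
* `coeff_farProd_mem` — **the coefficients of the far product lie in `m`** — PROVED.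

All statements are [folklore]; no definitions, no named facts.

## Sources

* M. Temkin, arXiv:0804.1554v3, proof of Thm. 3.3.1, Step 3 (p. 45) (the use: `K`-rational
  functions cutting out a Weierstrass neighbourhood, there through norms).
-/

noncomputable section

open scoped BigOperators
open Polynomial

namespace Literature.AlgebraicGeometry.Resolution

namespace ConjugateDiscs

universe u

/-- In a finite Galois extension, an element fixed by every automorphism lies in the ground
field. [folklore] -/
theorem mem_bot_of_forall_algEquiv {F E : Type*} [Field F] [Field E] [Algebra F E]
    [FiniteDimensional F E] [IsGalois F E] {x : E} (hx : ∀ θ : E ≃ₐ[F] E, θ x = x) :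
    x ∈ (⊥ : IntermediateField F E) := by
  have h : IntermediateField.fixedField (⊤ : Subgroup (E ≃ₐ[F] E)) = ⊥ := by
    rw [← IntermediateField.fixingSubgroup_bot, IsGalois.fixedField_fixingSubgroup]
  rw [← h, IntermediateField.mem_fixedField_iff]
  exact fun θ _ => hx θ

variable {Ω : Type u} [Field Ω] (V : ValuationSubring Ω) (m : Subfield Ω)

/-- **The far product is `m`-rational.** Let `M|m` be finite Galois inside `m̃ ⊆ Ω`, `a : I → M`
an injective family of conjugates permuted by `Gal(M|m)` (`hstab`) with `m`-rational centre
`a_{i₀}` (`ha₀`), `c ∈ m` non-zero, and suppose `Gal(M|m)` preserves `V` on `M` (`hθV`). Then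
every coefficient of `F = ∏_{i far} (X − aᵢ)` (far: `|aᵢ − a_{i₀}|_V > |c|_V`) lies in `m`.
[folklore] -/
theorem coeff_farProd_mem (M : IntermediateField m (algebraicClosure m Ω))
    [FiniteDimensional m M] [IsGalois m M]
    (hθV : ∀ (θ : M ≃ₐ[m] M) (z : M),
      (((θ z : M) : algebraicClosure m Ω) : Ω) ∈ V ↔ ((z : algebraicClosure m Ω) : Ω) ∈ V)
    {I : Type u} [Fintype I] (a : I → M) (ha : Function.Injective a) (i₀ : I)
    (hstab : ∀ (θ : M ≃ₐ[m] M) (i : I), ∃ j, θ (a i) = a j)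
    (ha₀ : ((a i₀ : algebraicClosure m Ω) : Ω) ∈ m) {c : Ω} (hcm : c ∈ m) (hc0 : c ≠ 0) (j : ℕ) :
    (∏ i ∈ far V.valuation (fun i => ((a i : algebraicClosure m Ω) : Ω)) i₀ (V.valuation c),
      (X - C ((a i : algebraicClosure m Ω) : Ω))).coeff j ∈ m := by
  classical
  -- the embedding `ι : M → Ω` and the constants `a_{i₀}`, `c` inside `M`
  set ι : M →+* Ω := (algebraMap (algebraicClosure m Ω) Ω).comp (algebraMap M (algebraicClosure m Ω))
    with hιdef
  have hι : ∀ z : M, ι z = ((z : algebraicClosure m Ω) : Ω) := fun _ => rfl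
  have hιinj : Function.Injective ι := ι.injective
  set γ := V.valuation c with hγ
  set farI := far V.valuation (fun i => ((a i : algebraicClosure m Ω) : Ω)) i₀ γ with hfarI
  let cM : M := algebraMap m M ⟨c, hcm⟩
  have hcM : ι cM = c := rfl
  let a₀ : M := algebraMap m M ⟨_, ha₀⟩
  have ha₀' : a i₀ = a₀ := hιinj rfl
  -- `Gal(M|m)` preserves far-ness
  have hle : ∀ w : M, V.valuation (ι w) ≤ γ ↔ ι (w / cM) ∈ V := fun w => by
    rw [map_div₀, hcM, ← V.valuation_le_one_iff, map_div₀,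
      div_le_one₀ ((Valuation.pos_iff _).mpr hc0)]
  have hfarθ : ∀ (θ : M ≃ₐ[m] M) {i j' : I}, θ (a i) = a j' → i ∈ farI → j' ∈ farI := by
    intro θ i j' hij hi
    rw [hfarI, mem_far] at hi ⊢
    change γ < V.valuation (ι (a j') - ι (a i₀))
    change γ < V.valuation (ι (a i) - ι (a i₀)) at hi
    rw [← map_sub, ← not_le, hle] at hi ⊢
    intro hmem
    apply hi
    have hθa₀ : θ (a i₀) = a i₀ := by rw [ha₀']; exact θ.commutes _
    have h1 : a j' - a i₀ = θ (a i - a i₀) := by rw [map_sub, hij, hθa₀]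
    have h2 : (a j' - a i₀) / cM = θ ((a i - a i₀) / cM) := by
      rw [map_div₀, ← h1]
      congr 1
      exact (θ.commutes _).symm
    rw [h2, hι, hθV θ] at hmem
    exact hmem
  -- the far product over `M` and its invariance
  set FM : M[X] := ∏ i ∈ farI, (X - C (a i)) with hFM
  have hFmap : (∏ i ∈ farI, (X - C ((a i : algebraicClosure m Ω) : Ω))) = FM.map ι := by
    rw [hFM, Polynomial.map_prod]
    refine Finset.prod_congr rfl fun i _ => ?_
    rw [Polynomial.map_sub, map_X, map_C, hι]
  have hinv : ∀ θ : M ≃ₐ[m] M, FM.map (θ : M →+* M) = FM := by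
    intro θ
    set S : Finset M := farI.image a with hS
    have hprod : FM = ∏ μ ∈ S, (X - C μ) := by
      rw [hFM, hS, Finset.prod_image fun x _ y _ h => ha h]
    have hSθ : S.image θ = S := by
      apply Finset.eq_of_subset_of_card_le
      · intro ν hν
        obtain ⟨μ, hμ, rfl⟩ := Finset.mem_image.mp hν
        obtain ⟨i, hi, rfl⟩ := Finset.mem_image.mp hμ
        obtain ⟨j', hj'⟩ := hstab θ i
        rw [hj']
        exact Finset.mem_image.mpr ⟨j', hfarθ θ hj' hi, rfl⟩
      · rw [Finset.card_image_of_injective _ θ.injective]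
    rw [hprod, Polynomial.map_prod]
    have h1 : ∏ μ ∈ S, (X - C μ : M[X]).map (θ : M →+* M) = ∏ μ ∈ S, (X - C (θ μ)) :=
      Finset.prod_congr rfl fun μ _ => by rw [Polynomial.map_sub, map_X, map_C]; rfl
    have h2 : ∏ ν ∈ S.image θ, (X - C ν : M[X]) = ∏ μ ∈ S, (X - C (θ μ)) :=
      Finset.prod_image fun x _ y _ h => θ.injective h
    rw [h1, ← h2, hSθ]
  -- the coefficients are fixed by `Gal(M|m)`, hence in `m`
  have hcoeff : FM.coeff j ∈ (⊥ : IntermediateField m M) := by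
    refine mem_bot_of_forall_algEquiv fun θ => ?_
    have h := congrArg (fun q : M[X] => q.coeff j) (hinv θ)
    simp only [Polynomial.coeff_map] at h
    exact h
  rw [hFmap, Polynomial.coeff_map]
  obtain ⟨c₀, hc₀⟩ := IntermediateField.mem_bot.mp hcoeff
  rw [← hc₀]
  exact c₀.2

end ConjugateDiscs

end Literature.AlgebraicGeometry.Resolution

end
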